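import Summits.ResolutionOfSingularities.ResolutionOfSingularities.Theorems.FrobeniusLadderFInjectiveMacaulayficationG5wConeClause
import Summits.ResolutionOfSingularities.ResolutionOfSingularities.Theorems.FrobeniusLadderFInjectiveMacaulayficationG5wVeronese
import Summits.ResolutionOfSingularities.ResolutionOfSingularities.Theorems.FrobeniusLadderFInjectiveMacaulayficationWeightedConeCore
import Mathlib.Algebra.MvPolynomial.PDeriv
import Mathlib.Algebra.CharP.Lemmas
import HarnessLib
import Summits.ResolutionOfSingularities.ResolutionOfSingularities.Theorems.FrobeniusLadderFInjectiveMacaulayficationFilteredConeFiModel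

/-!
# `f = z² + (y² + x³)³ + x¹⁰ + w⁵` at `p = 7`: the off-origin clause (isolated point), and ONE weighted blow-up modulo the filtered engine
# (crux `FInjectiveMacaulayfication`, line `graded-engine` §17 filtered engine, calibration G6h = idea-1 matrix row 13)

Support file for crux stmt-ResolutionOfSingularities-15315 (`FrobeniusLadder.FInjectiveMacaulayfication`), chain w45a,
seat res-L1-w45a-stub-3. [OURS · L1 W4.5a; idea-1 r2 TEST MATRIX row 13 («g + w⁵, p = 7, control, isolated at 0; one weighted
blow-up (10,15,45,18) — VERIFIED in-seat on charts»)] — NOT a statement of the manuscript; AI-written, weaker than expert review.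

* `g5w_offOrigin_clause_char7` — `hoff`: over any field of characteristic `7`, `V(f) ⊂ 𝔸⁴` is REGULAR at every closed point off the
  origin (so the clause holds there, `ClauseOfPderivNotMem`): if all four partials `∂₂ = 2X₂`, `∂₃ = 5X₃⁴`, `∂₁ = 6X₁φ²`,
  `∂₀ = 9X₀²φ² + 10X₀⁹` (`φ = X₁² + X₀³`) lay in `P ∋ f`, then `φ ∈ P` forces `10X₀⁹ ∈ P`, `X₀, X₁ ∈ P`, `P = 𝔪`; and `φ ∉ P` forces
  `X₁ ∈ P`, `X₀⁸(9 + 10X₀) ∈ P` (`G5wData.jacobian_identity`), `X₀⁹(1 + X₀) ∈ P` (`G5wData.cubic_identity`), whence `X₀ ∈ P` (so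
  `φ ∈ P`) or `−1 = (9 + 10X₀) − 10(1 + X₀) ∈ P` — absurd;
* `g5w_filteredFiModel_char7_of_filteredEngine` — the statement of G5♮ `FilteredEngine.filteredConeFiModel_of_filteredChartClause`
  (verbatim from `L/w45a/FilteredEngineSig.lean`, as a hypothesis) implies: over every field of characteristic `7` the threefold
  `Spec k[X₀,…,X₃]/(f)` has a proper birational model with Cohen–Macaulay F-injective domain stalks — the `(10,15,45,18)`-weighted blow-up
  `affineBlowup I₉₀` (`c = (9,6,2,5)`, `D = 90`), fed with `G5wVeronese` (saturation), `G5wData` (initial form, primality, `x̄ⱼ ≠ 0`),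
  `hoff` above and `hoff₀ = G5wConeClause.g5wCone_clause_char7`.

All proofs are glue on Mathlib and landed files; no definitions, no named facts. [folklore]
-/

-- single-problem summit: the doubled namespace component is forced
set_option linter.dupNamespace false

noncomputable section

open CategoryTheory AlgebraicGeometry

namespace Summit.ResolutionOfSingularities.ResolutionOfSingularities.Theorems.FInjectiveMacaulayfication.G5wFilteredFiModel

open MvPolynomial
open Summit.ResolutionOfSingularities.ResolutionOfSingularities.Theorems.FInjectiveMacaulayfication

/-- **THE OFF-ORIGIN CLAUSE FOR `f = z² + (y² + x³)³ + x¹⁰ + w⁵` AT `p = 7`** (`hoff` of the filtered engine): `V(f)` has an isolated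
singular point, so at every maximal ideal `Q` of `k[X]/(f)` missing some `x̄ⱼ` the Jacobian discharger gives the Cohen–Macaulay +
Frobenius-closed clause. [cite: Matsumura1987, Thm. 30.4 (ii)] -/
theorem g5w_offOrigin_clause_char7 (k : Type) [Field k] [CharP k 7] (f : MvPolynomial (Fin 4) k)
    (hf : f = MvPolynomial.X 2 ^ 2 + (MvPolynomial.X 1 ^ 2 + MvPolynomial.X 0 ^ 3) ^ 3 + MvPolynomial.X 0 ^ 10 +
      MvPolynomial.X 3 ^ 5) :
    ∀ (Q : Ideal (MvPolynomial (Fin 4) k ⧸ Ideal.span {f})) [Q.IsMaximal],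
      (∃ j : Fin 4, Ideal.Quotient.mk (Ideal.span {f}) (MvPolynomial.X j) ∉ Q) →
      ∀ d : ℕ, ringKrullDim (Localization.AtPrime Q) = d → ∀ s : Fin d → Localization.AtPrime Q,
        (Ideal.span (Set.range s)).radical.IsMaximal →
          RingTheory.Sequence.IsWeaklyRegular (Localization.AtPrime Q) (List.ofFn s) ∧
          ∀ y : Localization.AtPrime Q, (∃ e : ℕ, y ^ 7 ^ e ∈ Ideal.span
            ((fun z : Localization.AtPrime Q => z ^ 7 ^ e) ''
              (Ideal.span (Set.range s) : Set (Localization.AtPrime Q)))) → y ∈ Ideal.span (Set.range s) := by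
  haveI : Fact (Nat.Prime 7) := ⟨by norm_num⟩
  intro Q _ hj d hd s hs
  haveI hPmax : (Q.comap (Ideal.Quotient.mk (Ideal.span {f}))).IsMaximal :=
    Ideal.comap_isMaximal_of_surjective _ Ideal.Quotient.mk_surjective
  have hP := hPmax.isPrime
  have hfP : f ∈ Q.comap (Ideal.Quotient.mk (Ideal.span {f})) := by
    rw [Ideal.mem_comap, Ideal.Quotient.eq_zero_iff_mem.mpr (Ideal.mem_span_singleton_self f)]
    exact Q.zero_mem
  -- units in characteristic `7`
  have hu2 : IsUnit (2 : MvPolynomial (Fin 4) k) := by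
    simpa using G5wConeClause.isUnit_natCast_of_not_dvd 7 k 2 (by decide)
  have hu5 : IsUnit (5 : MvPolynomial (Fin 4) k) := by
    simpa using G5wConeClause.isUnit_natCast_of_not_dvd 7 k 5 (by decide)
  have hu6 : IsUnit (6 : MvPolynomial (Fin 4) k) := by
    simpa using G5wConeClause.isUnit_natCast_of_not_dvd 7 k 6 (by decide)
  have hu9 : IsUnit (9 : MvPolynomial (Fin 4) k) := by
    simpa using G5wConeClause.isUnit_natCast_of_not_dvd 7 k 9 (by decide)
  have hu10 : IsUnit (10 : MvPolynomial (Fin 4) k) := by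
    simpa using G5wConeClause.isUnit_natCast_of_not_dvd 7 k 10 (by decide)
  -- partial derivatives
  have hf' : f = X 2 ^ 2 + (X 1 ^ 2 + X 0 ^ 3) ^ 3 + (1 : ℕ) • X 0 ^ 10 + X 3 ^ 5 := by rw [hf, one_smul]
  have hd0 : pderiv 0 f = 9 * X 0 ^ 2 * (X 1 ^ 2 + X 0 ^ 3) ^ 2 + 10 * X 0 ^ 9 := by rw [hf, G5wData.pderiv_zero_g5w]
  have hd1 : pderiv 1 f = 6 * X 1 * (X 1 ^ 2 + X 0 ^ 3) ^ 2 := by rw [hf', G5wData.pderiv_one_g5w]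
  have hd2 : pderiv 2 f = 2 * X 2 := by rw [hf', G5wData.pderiv_two_g5w]
  have hd3 : pderiv 3 f = 5 * X 3 ^ 4 := by rw [hf', G5wData.pderiv_three_g5w]
  -- Jacobian exits
  by_cases m2 : pderiv 2 f ∈ Q.comap (Ideal.Quotient.mk (Ideal.span {f})); swap
  · exact ClauseOfPderivNotMem.stub_clauseOfPderivNotMem 7 k 4 f Q 2 m2 d hd s hs
  by_cases m3 : pderiv 3 f ∈ Q.comap (Ideal.Quotient.mk (Ideal.span {f})); swap
  · exact ClauseOfPderivNotMem.stub_clauseOfPderivNotMem 7 k 4 f Q 3 m3 d hd s hs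
  by_cases m1 : pderiv 1 f ∈ Q.comap (Ideal.Quotient.mk (Ideal.span {f})); swap
  · exact ClauseOfPderivNotMem.stub_clauseOfPderivNotMem 7 k 4 f Q 1 m1 d hd s hs
  by_cases m0 : pderiv 0 f ∈ Q.comap (Ideal.Quotient.mk (Ideal.span {f})); swap
  · exact ClauseOfPderivNotMem.stub_clauseOfPderivNotMem 7 k 4 f Q 0 m0 d hd s hs
  exfalso
  have hX2 : (X 2 : MvPolynomial (Fin 4) k) ∈ Q.comap (Ideal.Quotient.mk (Ideal.span {f})) := by
    rw [hd2] at m2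
    exact (Ideal.unit_mul_mem_iff_mem _ hu2).mp m2
  have hX3 : (X 3 : MvPolynomial (Fin 4) k) ∈ Q.comap (Ideal.Quotient.mk (Ideal.span {f})) := by
    rw [hd3] at m3
    exact hP.mem_of_pow_mem 4 ((Ideal.unit_mul_mem_iff_mem _ hu5).mp m3)
  -- not all variables lie in `P`
  have hnot : ¬ ((X 0 : MvPolynomial (Fin 4) k) ∈ Q.comap (Ideal.Quotient.mk (Ideal.span {f})) ∧
      (X 1 : MvPolynomial (Fin 4) k) ∈ Q.comap (Ideal.Quotient.mk (Ideal.span {f}))) := by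
    rintro ⟨h0, h1⟩
    obtain ⟨j, hj⟩ := hj
    apply hj
    fin_cases j
    · exact Ideal.mem_comap.mp h0
    · exact Ideal.mem_comap.mp h1
    · exact Ideal.mem_comap.mp hX2
    · exact Ideal.mem_comap.mp hX3
  rw [hd0] at m0
  rw [hd1, mul_assoc] at m1
  by_cases hφ : (X 1 ^ 2 + X 0 ^ 3 : MvPolynomial (Fin 4) k) ∈ Q.comap (Ideal.Quotient.mk (Ideal.span {f}))
  · -- `φ ∈ P`: `10X₀⁹ ∈ P`, so `X₀, X₁ ∈ P`
    have hX0 : (X 0 : MvPolynomial (Fin 4) k) ∈ Q.comap (Ideal.Quotient.mk (Ideal.span {f})) := by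
      have h10 : (10 * X 0 ^ 9 : MvPolynomial (Fin 4) k) ∈ Q.comap (Ideal.Quotient.mk (Ideal.span {f})) := by
        have e : (10 * X 0 ^ 9 : MvPolynomial (Fin 4) k) =
            (9 * X 0 ^ 2 * (X 1 ^ 2 + X 0 ^ 3) ^ 2 + 10 * X 0 ^ 9) - 9 * X 0 ^ 2 * (X 1 ^ 2 + X 0 ^ 3) * (X 1 ^ 2 + X 0 ^ 3) := by
          ring
        rw [e]
        exact Ideal.sub_mem _ m0 (Ideal.mul_mem_left _ _ hφ)
      exact hP.mem_of_pow_mem 9 ((Ideal.unit_mul_mem_iff_mem _ hu10).mp h10)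
    have hX1 : (X 1 : MvPolynomial (Fin 4) k) ∈ Q.comap (Ideal.Quotient.mk (Ideal.span {f})) := by
      refine hP.mem_of_pow_mem 2 ?_
      have e : (X 1 ^ 2 : MvPolynomial (Fin 4) k) = (X 1 ^ 2 + X 0 ^ 3) - X 0 * X 0 ^ 2 := by ring
      rw [e]
      exact Ideal.sub_mem _ hφ (Ideal.mul_mem_left _ _ (Ideal.pow_mem_of_mem _ hX0 2 (by norm_num)))
    exact hnot ⟨hX0, hX1⟩
  · -- `φ ∉ P`: then `X₁ ∈ P`, and the two identities produce a unit in `P`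
    have hX1 : (X 1 : MvPolynomial (Fin 4) k) ∈ Q.comap (Ideal.Quotient.mk (Ideal.span {f})) := by
      rcases hP.mem_or_mem ((Ideal.unit_mul_mem_iff_mem _ hu6).mp m1) with h1 | h1
      · exact h1
      · exact absurd (hP.mem_of_pow_mem 2 h1) hφ
    have hX0 : (X 0 : MvPolynomial (Fin 4) k) ∉ Q.comap (Ideal.Quotient.mk (Ideal.span {f})) := by
      intro hX0
      exact hφ (Ideal.add_mem _ (Ideal.pow_mem_of_mem _ hX1 2 (by norm_num)) (Ideal.pow_mem_of_mem _ hX0 3 (by norm_num)))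
    -- `X₀⁸ (9 + 10X₀) ∈ P`, hence `9 + 10X₀ ∈ P`
    have ht : (9 + 10 * X 0 : MvPolynomial (Fin 4) k) ∈ Q.comap (Ideal.Quotient.mk (Ideal.span {f})) := by
      have h8 : (X 0 ^ 8 * (9 + 10 * X 0) : MvPolynomial (Fin 4) k) ∈ Q.comap (Ideal.Quotient.mk (Ideal.span {f})) := by
        rw [← G5wData.jacobian_identity]
        have h12 : (X 1 ^ 2 : MvPolynomial (Fin 4) k) ∈ Q.comap (Ideal.Quotient.mk (Ideal.span {f})) :=
          Ideal.pow_mem_of_mem _ hX1 2 (by norm_num)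
        exact Ideal.sub_mem _ m0 (Ideal.mul_mem_right _ _ (Ideal.mul_mem_left _ (9 * X 0 ^ 2) h12))
      rcases hP.mem_or_mem h8 with h | h
      · exact absurd (hP.mem_of_pow_mem 8 h) hX0
      · exact h
    -- `X₀⁹ (1 + X₀) ∈ P`, hence `1 + X₀ ∈ P`
    have ht' : (1 + X 0 : MvPolynomial (Fin 4) k) ∈ Q.comap (Ideal.Quotient.mk (Ideal.span {f})) := by
      have h9 : (X 0 ^ 9 * (1 + X 0) : MvPolynomial (Fin 4) k) ∈ Q.comap (Ideal.Quotient.mk (Ideal.span {f})) := by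
        rw [← G5wData.cubic_identity]
        have e : ((X 1 ^ 2 + X 0 ^ 3) ^ 3 + X 0 ^ 10 : MvPolynomial (Fin 4) k) = f - X 2 * X 2 - X 3 ^ 4 * X 3 := by
          rw [hf]; ring
        rw [e]
        have h12 : (X 1 ^ 2 : MvPolynomial (Fin 4) k) ∈ Q.comap (Ideal.Quotient.mk (Ideal.span {f})) :=
          Ideal.pow_mem_of_mem _ hX1 2 (by norm_num)
        exact Ideal.sub_mem _ (Ideal.sub_mem _ (Ideal.sub_mem _ hfP (Ideal.mul_mem_left _ _ hX2))
          (Ideal.mul_mem_left _ _ hX3)) (Ideal.mul_mem_right _ _ h12)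
      rcases hP.mem_or_mem h9 with h | h
      · exact absurd (hP.mem_of_pow_mem 9 h) hX0
      · exact h
    -- `(9 + 10X₀) − 10(1 + X₀) = −1 ∈ P`
    refine hP.ne_top ((Ideal.eq_top_iff_one _).mpr ?_)
    have e : (1 : MvPolynomial (Fin 4) k) = 10 * (1 + X 0) - (9 + 10 * X 0) := by ring
    rw [e]
    exact Ideal.sub_mem _ (Ideal.mul_mem_left _ _ ht') ht

/-- **G6h modulo G5♮ — ONE `(10,15,45,18)`-WEIGHTED BLOW-UP F-INJECTIVIZES `z² + (y² + x³)³ + x¹⁰ + w⁵` AT `p = 7`, GIVEN THE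
FILTERED ENGINE** (idea-1 matrix row 13, the control threefold point, isolated at `0`): assuming the statement of plan-1's §17
filtered engine G5♮ `FilteredEngine.filteredConeFiModel_of_filteredChartClause` (hypothesis `hG5f`, verbatim from
`L/w45a/FilteredEngineSig.lean`), over every field `k` of characteristic `7`, `Spec k[X₀,…,X₃]/(f)` has a proper birational model (the
weighted blow-up of the origin, weights `(10,15,45,18)`, `affineBlowup I₉₀`, `c = (9,6,2,5)`, `D = 90`) all of whose stalks are domains
in which every system of parameters is weakly regular and generates a Frobenius closed ideal. [folklore] -/
theorem g5w_filteredFiModel_char7_of_filteredEngine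
    (hG5f : ∀ (p : ℕ) [Fact p.Prime] (k : Type) [Field k] [CharP k p] (n : ℕ) (w : Fin n → ℕ)
      (N D : ℕ) (c : Fin n → ℕ), 0 < N → (∀ v : Fin n, 0 < w v ∧ c v * w v = N) →
      (∀ (K : ℕ) (b : Fin n →₀ ℕ), K * N ≤ Finsupp.weight w b → (MvPolynomial.monomial b (1 : k) : MvPolynomial (Fin n) k) ∈
        (Ideal.span {m : MvPolynomial (Fin n) k | ∃ b : Fin n →₀ ℕ, N ≤ Finsupp.weight w b ∧ m = MvPolynomial.monomial b 1}) ^ K) →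
      ∀ (f f₀ : MvPolynomial (Fin n) k), f₀ = MvPolynomial.weightedHomogeneousComponent w D f →
      (∀ m < D, MvPolynomial.weightedHomogeneousComponent w m f = 0) → f₀ ≠ 0 → (Ideal.span {f}).IsPrime →
      (∀ v : Fin n, Ideal.Quotient.mk (Ideal.span {f}) (MvPolynomial.X v) ≠ 0) →
      (∀ (Q : Ideal (MvPolynomial (Fin n) k ⧸ Ideal.span {f})) [Q.IsMaximal],
        (∃ j : Fin n, Ideal.Quotient.mk (Ideal.span {f}) (MvPolynomial.X j) ∉ Q) →
        ∀ d : ℕ, ringKrullDim (Localization.AtPrime Q) = d → ∀ s : Fin d → Localization.AtPrime Q,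
          (Ideal.span (Set.range s)).radical.IsMaximal →
            RingTheory.Sequence.IsWeaklyRegular (Localization.AtPrime Q) (List.ofFn s) ∧
            ∀ y : Localization.AtPrime Q, (∃ e : ℕ, y ^ p ^ e ∈ Ideal.span
              ((fun z : Localization.AtPrime Q => z ^ p ^ e) ''
                (Ideal.span (Set.range s) : Set (Localization.AtPrime Q)))) → y ∈ Ideal.span (Set.range s)) →
      (∀ (Q : Ideal (MvPolynomial (Fin n) k ⧸ Ideal.span {f₀})) [Q.IsMaximal],
        (∃ j : Fin n, Ideal.Quotient.mk (Ideal.span {f₀}) (MvPolynomial.X j) ∉ Q) →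
        ∀ d : ℕ, ringKrullDim (Localization.AtPrime Q) = d → ∀ s : Fin d → Localization.AtPrime Q,
          (Ideal.span (Set.range s)).radical.IsMaximal →
            RingTheory.Sequence.IsWeaklyRegular (Localization.AtPrime Q) (List.ofFn s) ∧
            ∀ y : Localization.AtPrime Q, (∃ e : ℕ, y ^ p ^ e ∈ Ideal.span
              ((fun z : Localization.AtPrime Q => z ^ p ^ e) ''
                (Ideal.span (Set.range s) : Set (Localization.AtPrime Q)))) → y ∈ Ideal.span (Set.range s)) →
      ∃ (X' : Scheme.{0}) (π : X' ⟶ Spec (.of (MvPolynomial (Fin n) k ⧸ Ideal.span {f}))), IsProper π ∧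
        Literature.AlgebraicGeometry.Resolution.IsBirational π ∧
        ∀ y : X', IsDomain (X'.presheaf.stalk y) ∧ ∀ d : ℕ, ringKrullDim (X'.presheaf.stalk y) = d →
          ∀ s : Fin d → X'.presheaf.stalk y, (Ideal.span (Set.range s)).radical.IsMaximal →
            RingTheory.Sequence.IsWeaklyRegular (X'.presheaf.stalk y) (List.ofFn s) ∧
            ∀ z : X'.presheaf.stalk y, (∃ e : ℕ, z ^ p ^ e ∈
                Ideal.span ((fun w : X'.presheaf.stalk y => w ^ p ^ e) ''
                  (Ideal.span (Set.range s) : Set (X'.presheaf.stalk y)))) →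
              z ∈ Ideal.span (Set.range s)) :
    ∀ (k : Type) [Field k] [CharP k 7] (f : MvPolynomial (Fin 4) k),
      f = MvPolynomial.X 2 ^ 2 + (MvPolynomial.X 1 ^ 2 + MvPolynomial.X 0 ^ 3) ^ 3 + MvPolynomial.X 0 ^ 10 +
        MvPolynomial.X 3 ^ 5 →
      ∃ (X' : Scheme.{0}) (π : X' ⟶ Spec (.of (MvPolynomial (Fin 4) k ⧸ Ideal.span {f}))), IsProper π ∧
        Literature.AlgebraicGeometry.Resolution.IsBirational π ∧
        ∀ y : X', IsDomain (X'.presheaf.stalk y) ∧ ∀ d : ℕ, ringKrullDim (X'.presheaf.stalk y) = d →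
          ∀ s : Fin d → X'.presheaf.stalk y, (Ideal.span (Set.range s)).radical.IsMaximal →
            RingTheory.Sequence.IsWeaklyRegular (X'.presheaf.stalk y) (List.ofFn s) ∧
            ∀ z : X'.presheaf.stalk y, (∃ e : ℕ, z ^ 7 ^ e ∈
                Ideal.span ((fun w : X'.presheaf.stalk y => w ^ 7 ^ e) ''
                  (Ideal.span (Set.range s) : Set (X'.presheaf.stalk y)))) →
              z ∈ Ideal.span (Set.range s) := by
  intro k _ _ f hf
  haveI : Fact (Nat.Prime 7) := ⟨by norm_num⟩
  exact hG5f 7 k 4 ![10, 15, 45, 18] 90 90 ![9, 6, 2, 5] (by norm_num) (by decide)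
    (G5wVeronese.g5wVeroneseSplitting k) f (X 2 ^ 2 + (X 1 ^ 2 + X 0 ^ 3) ^ 3 + X 3 ^ 5)
    (G5wData.weightedHomogeneousComponent_ninety k f hf).symm (G5wData.weightedHomogeneousComponent_lt_ninety k f hf)
    (G5wData.F0_ne_zero k) (G5wData.span_g5w_isPrime k f hf) (G5wData.g5w_X_ne_zero k f hf)
    (g5w_offOrigin_clause_char7 k f hf) (G5wConeClause.g5wCone_clause_char7 k _ rfl)

/-- **`z² + (y² + x³)³ + x¹⁰ + w⁵` IN CHARACTERISTIC 7 IS F-INJECTIVELY MACAULAYFIED BY ONE `(10,15,45,18)`-WEIGHTED BLOW-UP —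
UNCONDITIONAL** (G6h; the filtered engine G5♮ `FilteredConeFiModel.filteredConeFiModel` has LANDED): the first calibration whose
`hoff₀` stratum is NON-LINEAR (the cuspidal curve of the weighted tangent cone). [folklore] -/
theorem g5w_filteredFiModel_char7 :
    ∀ (k : Type) [Field k] [CharP k 7] (f : MvPolynomial (Fin 4) k),
      f = MvPolynomial.X 2 ^ 2 + (MvPolynomial.X 1 ^ 2 + MvPolynomial.X 0 ^ 3) ^ 3 + MvPolynomial.X 0 ^ 10 +
        MvPolynomial.X 3 ^ 5 →
      ∃ (X' : Scheme.{0}) (π : X' ⟶ Spec (.of (MvPolynomial (Fin 4) k ⧸ Ideal.span {f}))), IsProper π ∧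
        Literature.AlgebraicGeometry.Resolution.IsBirational π ∧
        ∀ y : X', IsDomain (X'.presheaf.stalk y) ∧ ∀ d : ℕ, ringKrullDim (X'.presheaf.stalk y) = d →
          ∀ s : Fin d → X'.presheaf.stalk y, (Ideal.span (Set.range s)).radical.IsMaximal →
            RingTheory.Sequence.IsWeaklyRegular (X'.presheaf.stalk y) (List.ofFn s) ∧
            ∀ z : X'.presheaf.stalk y, (∃ e : ℕ, z ^ 7 ^ e ∈
                Ideal.span ((fun w : X'.presheaf.stalk y => w ^ 7 ^ e) ''
                  (Ideal.span (Set.range s) : Set (X'.presheaf.stalk y)))) →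
              z ∈ Ideal.span (Set.range s) :=
  g5w_filteredFiModel_char7_of_filteredEngine FilteredConeFiModel.filteredConeFiModel

end Summit.ResolutionOfSingularities.ResolutionOfSingularities.Theorems.FInjectiveMacaulayfication.G5wFilteredFiModel

end
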